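import Summits.CriticalPhenomena.PercolationContinuityZ3.Theorems.PercNearOneGluingNoHeavyLowerTailSahiOneStepTwoChainProfile
import HarnessLib

/-!
# The TWO-CHAIN COLLAPSE THEOREM for up-sets of a grid (gen-20's conjecture 2CH, all levels)

Support file (prover prim-ineq-prove-3 gen 24; `--supports stmt-CriticalPhenomena-4575`; memo
`run/shared/lean/prim/prim-ineq-prove-3/FINDING-G24-TWO-CHAIN.md` §1).  No definitions, no sorries.

Grid `{0..K} × {0..J}` with product weights `a k * b j` (`a, b ≥ 0`, each summing to `1`), the "Hamming" up-set `H = {t ≤ k + j}`,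
`L = Hᶜ`, and two up-sets `A = {PA}`, `B = {PB}` of the grid (predicates monotone in both coordinates).  Then
  `μ(A∩L)·μ(B∩L) + μ(L)·μ(H∩A∩B) − μ(L)·μ(A)·μ(B) ≥ 0`,
i.e. `Cov(1_A,1_B) ≥ μ(L)·Cov(1_A,1_B ∣ L)` — the same shape as `…SubblockGrid.grid_osN_nonneg` (which is the case `A` arbitrary
sub-probability cell masses, `B = {r ≤ k}`); here BOTH events are arbitrary grid up-sets.  Proof: column profiles
`x k = b{j : PA k j}`, `y k = b{j : PB k j}`, `z k = b{j : t ≤ k+j}` are nondecreasing and `[0,1]`-valued, the column sections are nested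
final segments (so intersections have mass `min`), and `…TwoChainProfile.profile_nonneg` applies.
Main result: `grid_collapse_upset`.
-/

namespace Summit.CriticalPhenomena.PercolationContinuityZ3.Theorems

namespace SahiOneStep

namespace TwoChain

open Finset

/-- Two upward-closed predicates on `ℕ` are nested. [folklore] -/
theorem upward_nested (P Q : ℕ → Prop) (hP : ∀ j j', j ≤ j' → P j → P j') (hQ : ∀ j j', j ≤ j' → Q j → Q j') :
    (∀ j, P j → Q j) ∨ (∀ j, Q j → P j) := by
  by_contra h
  rw [not_or] at h
  obtain ⟨h1, h2⟩ := h
  push Not at h1 h2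
  obtain ⟨j1, hP1, hQ1⟩ := h1
  obtain ⟨j2, hQ2, hP2⟩ := h2
  rcases le_total j1 j2 with h12 | h21
  · exact hP2 (hP j1 j2 h12 hP1)
  · exact hQ1 (hQ j2 j1 h21 hQ2)

/-- Mass of the intersection of two nested final segments = `min` of the masses. [folklore] -/
theorem sum_ite_and_eq_min (S : Finset ℕ) (b : ℕ → ℝ) (hb : ∀ j, 0 ≤ b j) (P Q : ℕ → Prop) [DecidablePred P] [DecidablePred Q]
    (hP : ∀ j j', j ≤ j' → P j → P j') (hQ : ∀ j j', j ≤ j' → Q j → Q j') :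
    (∑ j ∈ S, if P j ∧ Q j then b j else 0) = min (∑ j ∈ S, if P j then b j else 0) (∑ j ∈ S, if Q j then b j else 0) := by
  rcases upward_nested P Q hP hQ with hPQ | hQP
  · have e : (∑ j ∈ S, if P j ∧ Q j then b j else 0) = ∑ j ∈ S, if P j then b j else 0 :=
      Finset.sum_congr rfl fun j _ => by
        by_cases hp : P j
        · rw [if_pos ⟨hp, hPQ j hp⟩, if_pos hp]
        · rw [if_neg (fun h => hp h.1), if_neg hp]
    have le : (∑ j ∈ S, if P j then b j else 0) ≤ ∑ j ∈ S, if Q j then b j else 0 :=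
      Finset.sum_le_sum fun j _ => by
        by_cases hp : P j
        · rw [if_pos hp, if_pos (hPQ j hp)]
        · rw [if_neg hp]; by_cases hq : Q j
          · rw [if_pos hq]; exact hb j
          · rw [if_neg hq]
    rw [e, min_eq_left le]
  · have e : (∑ j ∈ S, if P j ∧ Q j then b j else 0) = ∑ j ∈ S, if Q j then b j else 0 :=
      Finset.sum_congr rfl fun j _ => by
        by_cases hq : Q j
        · rw [if_pos ⟨hQP j hq, hq⟩, if_pos hq]
        · rw [if_neg (fun h => hq h.2), if_neg hq]
    have le : (∑ j ∈ S, if Q j then b j else 0) ≤ ∑ j ∈ S, if P j then b j else 0 :=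
      Finset.sum_le_sum fun j _ => by
        by_cases hq : Q j
        · rw [if_pos hq, if_pos (hQP j hq)]
        · rw [if_neg hq]; by_cases hp : P j
          · rw [if_pos hp]; exact hb j
          · rw [if_neg hp]
    rw [e, min_eq_right le]

/-- Splitting a restricted sum along a predicate. [folklore] -/
theorem sum_ite_split (S : Finset ℕ) (f : ℕ → ℝ) (P Q : ℕ → Prop) [DecidablePred P] [DecidablePred Q] :
    (∑ j ∈ S, if P j then f j else 0) = (∑ j ∈ S, if Q j ∧ P j then f j else 0) + ∑ j ∈ S, if ¬ Q j ∧ P j then f j else 0 := by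
  rw [← Finset.sum_add_distrib]
  refine Finset.sum_congr rfl fun j _ => ?_
  by_cases hq : Q j <;> by_cases hp : P j <;> simp [hq, hp]

/-- **TWO-CHAIN COLLAPSE THEOREM for grid up-sets** (memo §1): with `H = {t ≤ k+j}`, `L = Hᶜ` and grid up-sets `A, B`,
`μ(A∩L)μ(B∩L) + μ(L)μ(H∩A∩B) − μ(L)μ(A)μ(B) ≥ 0` for every product probability weight `a ⊗ b` on `{0..K}×{0..J}`. [this work] -/
theorem grid_collapse_upset (K J t : ℕ) (a b : ℕ → ℝ) (PA PB : ℕ → ℕ → Prop) [∀ k j, Decidable (PA k j)] [∀ k j, Decidable (PB k j)]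
    (ha : ∀ k, 0 ≤ a k) (hb : ∀ j, 0 ≤ b j) (hA1 : ∑ k ∈ range (K + 1), a k = 1) (hB1 : ∑ j ∈ range (J + 1), b j = 1)
    (hPAk : ∀ k k' j, k ≤ k' → PA k j → PA k' j) (hPAj : ∀ k j j', j ≤ j' → PA k j → PA k j')
    (hPBk : ∀ k k' j, k ≤ k' → PB k j → PB k' j) (hPBj : ∀ k j j', j ≤ j' → PB k j → PB k j') :
    0 ≤ (∑ k ∈ range (K + 1), ∑ j ∈ range (J + 1), if k + j < t ∧ PA k j then a k * b j else 0) *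
          (∑ k ∈ range (K + 1), ∑ j ∈ range (J + 1), if k + j < t ∧ PB k j then a k * b j else 0)
        + (∑ k ∈ range (K + 1), ∑ j ∈ range (J + 1), if k + j < t then a k * b j else 0) *
          (∑ k ∈ range (K + 1), ∑ j ∈ range (J + 1), if t ≤ k + j ∧ (PA k j ∧ PB k j) then a k * b j else 0)
        - (∑ k ∈ range (K + 1), ∑ j ∈ range (J + 1), if k + j < t then a k * b j else 0) *
          (∑ k ∈ range (K + 1), ∑ j ∈ range (J + 1), if PA k j then a k * b j else 0) *
          (∑ k ∈ range (K + 1), ∑ j ∈ range (J + 1), if PB k j then a k * b j else 0) := by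
  set SJ := range (J + 1) with hSJ
  -- column profiles
  set x : ℕ → ℝ := fun k => ∑ j ∈ SJ, if PA k j then b j else 0 with hx
  set y : ℕ → ℝ := fun k => ∑ j ∈ SJ, if PB k j then b j else 0 with hy
  set z : ℕ → ℝ := fun k => ∑ j ∈ SJ, if t ≤ k + j then b j else 0 with hz
  -- generic facts about restricted sums of `b`
  have rs_nonneg : ∀ (P : ℕ → Prop) [DecidablePred P], 0 ≤ ∑ j ∈ SJ, if P j then b j else 0 :=
    fun P _ => Finset.sum_nonneg fun j _ => by by_cases h : P j <;> simp [h, hb j]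
  have rs_le_one : ∀ (P : ℕ → Prop) [DecidablePred P], (∑ j ∈ SJ, if P j then b j else 0) ≤ 1 := by
    intro P _
    rw [← hB1]
    exact Finset.sum_le_sum fun j _ => by by_cases h : P j <;> simp [h, hb j]
  have rs_mono : ∀ (P Q : ℕ → Prop) [DecidablePred P] [DecidablePred Q], (∀ j, P j → Q j) →
      (∑ j ∈ SJ, if P j then b j else 0) ≤ ∑ j ∈ SJ, if Q j then b j else 0 := by
    intro P Q _ _ hPQ
    exact Finset.sum_le_sum fun j _ => by
      by_cases hp : P j
      · rw [if_pos hp, if_pos (hPQ j hp)]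
      · rw [if_neg hp]; by_cases hq : Q j
        · rw [if_pos hq]; exact hb j
        · rw [if_neg hq]
  have hxm : Monotone x := by
    intro k k' hkk'
    simp only [hx]
    exact rs_mono _ _ fun j => hPAk k k' j hkk'
  have hym : Monotone y := by
    intro k k' hkk'
    simp only [hy]
    exact rs_mono _ _ fun j => hPBk k k' j hkk'
  have hzm : Monotone z := by
    intro k k' hkk'
    simp only [hz]
    exact rs_mono _ _ fun j h => le_trans h (Nat.add_le_add_right hkk' j)
  have hx0 : ∀ k, 0 ≤ x k := fun k => rs_nonneg _
  have hy0 : ∀ k, 0 ≤ y k := fun k => rs_nonneg _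
  have hz0 : ∀ k, 0 ≤ z k := fun k => rs_nonneg _
  have hx1 : ∀ k, x k ≤ 1 := fun k => rs_le_one _
  have hy1 : ∀ k, y k ≤ 1 := fun k => rs_le_one _
  have hz1 : ∀ k, z k ≤ 1 := fun k => rs_le_one _
  -- column identities
  have cHA : ∀ k, (∑ j ∈ SJ, if t ≤ k + j ∧ PA k j then b j else 0) = min (z k) (x k) := fun k =>
    sum_ite_and_eq_min SJ b hb (fun j => t ≤ k + j) (PA k) (fun j j' hjj' h => le_trans h (Nat.add_le_add_left hjj' k))
      (hPAj k)
  have cHB : ∀ k, (∑ j ∈ SJ, if t ≤ k + j ∧ PB k j then b j else 0) = min (z k) (y k) := fun k =>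
    sum_ite_and_eq_min SJ b hb (fun j => t ≤ k + j) (PB k) (fun j j' hjj' h => le_trans h (Nat.add_le_add_left hjj' k))
      (hPBj k)
  have cAB : ∀ k, (∑ j ∈ SJ, if PA k j ∧ PB k j then b j else 0) = min (x k) (y k) := fun k =>
    sum_ite_and_eq_min SJ b hb (PA k) (PB k) (hPAj k) (hPBj k)
  have cHAB : ∀ k, (∑ j ∈ SJ, if t ≤ k + j ∧ (PA k j ∧ PB k j) then b j else 0) = min (min (x k) (y k)) (z k) := by
    intro k
    rw [sum_ite_and_eq_min SJ b hb (fun j => t ≤ k + j) (fun j => PA k j ∧ PB k j)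
      (fun j j' hjj' h => le_trans h (Nat.add_le_add_left hjj' k)) (fun j j' hjj' h => ⟨hPAj k j j' hjj' h.1, hPBj k j j' hjj' h.2⟩),
      cAB k, min_comm]
  have cL : ∀ k, (∑ j ∈ SJ, if k + j < t then b j else 0) = 1 - z k := by
    intro k
    have h := sum_ite_split SJ b (fun _ => True) (fun j => t ≤ k + j)
    simp only [and_true] at h
    have h1 : (∑ j ∈ SJ, if True then b j else 0) = 1 := by simp [hB1]
    rw [h1] at h
    have h2 : (∑ j ∈ SJ, if ¬ t ≤ k + j then b j else 0) = ∑ j ∈ SJ, if k + j < t then b j else 0 :=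
      Finset.sum_congr rfl fun j _ => by simp only [not_le]
    rw [← h2]; simp only [hz]; linarith
  have cLA : ∀ k, (∑ j ∈ SJ, if k + j < t ∧ PA k j then b j else 0) = max (x k - z k) 0 := by
    intro k
    have h := sum_ite_split SJ b (PA k) (fun j => t ≤ k + j)
    have h2 : (∑ j ∈ SJ, if ¬ t ≤ k + j ∧ PA k j then b j else 0) = ∑ j ∈ SJ, if k + j < t ∧ PA k j then b j else 0 :=
      Finset.sum_congr rfl fun j _ => by simp only [not_le]
    rw [cHA k] at h
    rw [← h2]
    have hxk : x k = ∑ j ∈ SJ, if PA k j then b j else 0 := rfl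
    rcases le_total (z k) (x k) with hzx | hxz
    · rw [min_eq_left hzx] at h; rw [max_eq_left (sub_nonneg.2 hzx)]; linarith
    · rw [min_eq_right hxz] at h; rw [max_eq_right (sub_nonpos.2 hxz)]; linarith
  have cLB : ∀ k, (∑ j ∈ SJ, if k + j < t ∧ PB k j then b j else 0) = max (y k - z k) 0 := by
    intro k
    have h := sum_ite_split SJ b (PB k) (fun j => t ≤ k + j)
    have h2 : (∑ j ∈ SJ, if ¬ t ≤ k + j ∧ PB k j then b j else 0) = ∑ j ∈ SJ, if k + j < t ∧ PB k j then b j else 0 :=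
      Finset.sum_congr rfl fun j _ => by simp only [not_le]
    rw [cHB k] at h
    rw [← h2]
    have hyk : y k = ∑ j ∈ SJ, if PB k j then b j else 0 := rfl
    rcases le_total (z k) (y k) with hzy | hyz
    · rw [min_eq_left hzy] at h; rw [max_eq_left (sub_nonneg.2 hzy)]; linarith
    · rw [min_eq_right hyz] at h; rw [max_eq_right (sub_nonpos.2 hyz)]; linarith
  -- factor the column weight out of each double sum
  have fac : ∀ (P : ℕ → ℕ → Prop) [∀ k j, Decidable (P k j)],
      (∑ k ∈ range (K + 1), ∑ j ∈ SJ, if P k j then a k * b j else 0)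
        = ∑ k ∈ range (K + 1), a k * ∑ j ∈ SJ, if P k j then b j else 0 := by
    intro P _
    refine Finset.sum_congr rfl fun k _ => ?_
    rw [Finset.mul_sum]
    refine Finset.sum_congr rfl fun j _ => ?_
    by_cases h : P k j <;> simp [h]
  rw [fac (fun k j => k + j < t ∧ PA k j), fac (fun k j => k + j < t ∧ PB k j), fac (fun k j => k + j < t),
    fac (fun k j => t ≤ k + j ∧ (PA k j ∧ PB k j)), fac PA, fac PB]
  simp only [cLA, cLB, cL, cHAB]
  have main := profile_nonneg K a x y z ha hA1 hxm hym hzm hx0 hy0 hz0 hx1 hy1 hz1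
  have ex : (∑ k ∈ range (K + 1), a k * ∑ j ∈ SJ, if PA k j then b j else 0) = ∑ k ∈ range (K + 1), a k * x k := rfl
  have ey : (∑ k ∈ range (K + 1), a k * ∑ j ∈ SJ, if PB k j then b j else 0) = ∑ k ∈ range (K + 1), a k * y k := rfl
  rw [ex, ey]
  nlinarith [main]

end TwoChain

end SahiOneStep

end Summit.CriticalPhenomena.PercolationContinuityZ3.Theorems
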